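import Literature.AnabelianGeometry.EtaleTheta.Discharge.Sec5OfThetaSetting
import Literature.AnabelianGeometry.EtaleTheta.Discharge.Sec5FactsMembersOfConnectedTemperoidYdd

/-!
# [EtTh] §5 / Lemma 5.8: the `Facts` members AT THE §5 DATA OF THE SETTING with `A_⊙^bs := Ÿ̲̲` (`ofThetaSettingData` over `mkOfThetaSettingYdd`) —
# F-0543 / F-0738 binder-free, F-0535 / F-0536 ⟸ {`hconst`, `hgc`}

S. Mochizuki, *The étale theta function and its Frobenioid-theoretic manifestations*, Publ. RIMS **45** (2009), §5 pp. 330–331, Lemma 5.8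
p. 331 (PDF p. 105) [cite: MochizukiEtTh2009, Lem 5.8 p.331 (PDF p.105)].

abc-iut cell, D-0079 ORIGINAL-L / L-F [EtTh] (FACT rows F-0543 `SgpCupSection`, F-0738 `SgpCapSection`, F-0535 `ConstantsActByCyclotome`,
F-0536 `ConstantsEqNormalizer`; nodes `EtTh:Lem5.8`, `EtTh:§5-data`), seat abc-iut-w6-d053 (gen 5), companion of the census `LF-ETTH-S5A.tsv`.
PROOF-ONLY (0 definitions, no instance, no new `Prop`).  abc-iut-L2-t4's junction `ofThetaSettingData μ hC hS h Q R K' …` IS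
`ofConnectedTemperoidData (T := C.thetaEnvData μ hC hS) … (ContinuousMulEquiv.refl _) …` (`ofThetaSettingData_eq`, `rfl`) and
`BiKummerSetting.mkOfThetaSettingYdd` is an `abbrev` for `mkOfConnectedTemperoidYdd … (C.thetaEnvData μ hC hS) (refl)`; hence this seat's
generic Ÿ-data closers (`Discharge/Sec5FactsMembersOfConnectedTemperoidYdd.lean`, p454563) and abc-iut-L2-t4's `facts_ofThetaSettingYddData`
(`Discharge/Sec5OfThetaSetting.lean`) give, AT THE SETTING'S OWN §5 DATA (the `Π^tp_X̲̲ = C.Huu` of a theta setting, `A_⊙^bs := Ÿ̲̲`):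
* `sgpCupSection_ofThetaSettingYddData` — **F-0543, NO hypothesis beyond the data**;
* `sgpCapSection_ofThetaSettingYddData` — **F-0738, idem**;
* `constantsActByCyclotome_ofThetaSettingYddData` — **F-0535 ⟸ {`hconst`, `hgc`}**;
* `constantsEqNormalizer_ofThetaSettingYddData` — **F-0536 ⟸ {`hconst`, `hgc`}** (Lemma 5.8's main assertion).
Everything BY NAME; nothing landed is edited or restated.
HONEST FRAMING: kernel re-keying at the junction; `tf` (a tempered Frobenioid over `B^temp(Π^tp_X̲̲)⁰`) is an abstract parameter; `hconst`
(Def. 3.6 (iii)) and `hgc` (geometric connectedness of `Ÿ` over `K`) remain the printed arithmetic inputs; nothing here bears on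
[IUTchIII] Cor. 3.12; no side taken; typed ≠ proved.
-/

noncomputable section

namespace Literature.AnabelianGeometry.EtaleTheta

open CategoryTheory Opposite Literature.AlgebraicGeometry.Frobenioids Literature.AnabelianGeometry.SemiGraphs

universe v₀

namespace ThetaFrobenioid


variable {p : ℕ} [Fact p.Prime] {D : ThetaSetting p} {E : D.EtaleThetaData} {l : ℕ} {C : E.DoubleUnderline l}
  {e : D.toTemperedCurve.GroupLevelData} {N : ℕ+} (μ : D.CyclotomeMod l N) (hC : D.Compat) (hS : D.Sec2Hyps)
  {D₀ : Type} [Category.{v₀} D₀] {V : FrdIMonoidStub.{0}} {T₀ : RealifiedDivisorMonoids (D₀ := D₀) V}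
  {VD : FrdICatStub.{1, 0, 0} (ConnectedPart (BTemp (C.temperedArithmeticGroup e).Pi))}
  {tf : TemperedFrobenioid T₀ (ConnectedPart (BTemp (C.temperedArithmeticGroup e).Pi)) VD} {hZ : tf.monoidType = MonoidType.Z}
  {hP : ∀ A : (ConnectedPart (BTemp (C.temperedArithmeticGroup e).Pi))ᵒᵖ, IsPerfect (tf.Φ.carrier A)}
  {NH : Subgroup (Field.absoluteGaloisGroup D.K) → tf.category → ℕ+ → Prop}
  {pullFrac : ∀ {A A' : (BiKummerSetting.mkOfThetaSettingYdd C e μ hC hS tf hZ hP NH).C} (_ : A' ⟶ A),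
    (BiKummerSetting.mkOfThetaSettingYdd C e μ hC hS tf hZ hP NH).biratUnits A →
      (BiKummerSetting.mkOfThetaSettingYdd C e μ hC hS tf hZ hP NH).biratUnits A'}
  {θ : (BiKummerSetting.mkOfThetaSettingYdd C e μ hC hS tf hZ hP NH).biratUnits (BiKummerSetting.mkOfThetaSettingYdd C e μ hC hS tf hZ hP NH).Aodot}
  {Bl : (BiKummerSetting.mkOfThetaSettingYdd C e μ hC hS tf hZ hP NH).C}
  {Pl : (BiKummerSetting.mkOfThetaSettingYdd C e μ hC hS tf hZ hP NH).FractionPair θ Bl}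
  {Rl : (BiKummerSetting.mkOfThetaSettingYdd C e μ hC hS tf hZ hP NH).NthRoot θ Pl C.lPNat pullFrac}
  (h : ModelFrobenioid.Hypotheses tf.divisorMonoid tf.ratFnFunctor)
  (Q : FrobenioidTheta.ThetaSubquotientStub.{0} (ConnectedPart (BTemp (C.temperedArithmeticGroup e).Pi)))
  (R : (BiKummerSetting.mkOfThetaSettingYdd C e μ hC hS tf hZ hP NH).NthRoot Rl.root Rl.pair N pullFrac)
  (K' : Type) [Field K'] (constEmb : K'ˣ →* tf.biratUnitsModel R.BN) (constEmb_injective : Function.Injective constEmb)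
  (hinvc : ∀ g : Aut R.AN.base,
    pull tf.divisorMonoid g.hom (ModelFrobenioid.div R.pair.num) = ModelFrobenioid.div R.pair.num)
  (hinvp : ∀ y : (C.thetaEnvData μ hC hS).PiX, y ∈ (C.thetaEnvData μ hC hS).PiYdd →
    pull tf.divisorMonoid ((BiKummerSetting.mkOfThetaSettingYdd C e μ hC hS tf hZ hP NH).galoisSurj
      R.AN.base R.αData.isGalois ((ContinuousMulEquiv.refl _) y)).hom (ModelFrobenioid.div R.pair.den) = ModelFrobenioid.div R.pair.den)

/-- **F-0543 `SgpCupSection` at the §5 data of the Setting (`A_⊙^bs := Ÿ̲̲`), NO hypothesis beyond the data.** [cite: MochizukiEtTh2009, §5 p.331 (PDF p.105)] -/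
theorem sgpCupSection_ofThetaSettingYddData :
    (ofThetaSettingData μ hC hS h Q R K' constEmb constEmb_injective hinvc hinvp).SgpCupSection :=
  sgpCupSection_ofConnectedTemperoidYddData (T := C.thetaEnvData μ hC hS) h Q C.odd_lPNat R K' constEmb constEmb_injective hinvc hinvp

/-- **F-0738 `SgpCapSection` at the §5 data of the Setting, NO hypothesis beyond the data** (abc-iut-L2-t4's generic
`sgpCapSection_ofConnectedTemperoidData`). [cite: MochizukiEtTh2009, §5 p.331 (PDF p.105)] -/
theorem sgpCapSection_ofThetaSettingYddData :
    (ofThetaSettingData μ hC hS h Q R K' constEmb constEmb_injective hinvc hinvp).SgpCapSection :=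
  sgpCapSection_ofConnectedTemperoidData (T := C.thetaEnvData μ hC hS) h Q C.odd_lPNat R (ContinuousMulEquiv.refl _) K' constEmb
    constEmb_injective hinvc hinvp

section Constants

variable
  (hconst : ∀ (ε : Aut R.BN) (k : K'ˣ), tf.biratAutModel R.BN ε (constEmb k) = constEmb k)
  (hgc : ∀ u : (ofThetaSettingData μ hC hS h Q R K' constEmb constEmb_injective hinvc hinvp).units
      (ofThetaSettingData μ hC hS h Q R K' constEmb constEmb_injective hinvc hinvp).BN,
    (∀ y ∈ (ofThetaSettingData μ hC hS h Q R K' constEmb constEmb_injective hinvc hinvp).imPiY,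
      (ofThetaSettingData μ hC hS h Q R K' constEmb constEmb_injective hinvc hinvp).sgpCap y *
        (u : Aut (ofThetaSettingData μ hC hS h Q R K' constEmb constEmb_injective hinvc hinvp).BN) *
        ((ofThetaSettingData μ hC hS h Q R K' constEmb constEmb_injective hinvc hinvp).sgpCap y)⁻¹ = u) →
    (ofThetaSettingData μ hC hS h Q R K' constEmb constEmb_injective hinvc hinvp).unitsToBirat
        (ofThetaSettingData μ hC hS h Q R K' constEmb constEmb_injective hinvc hinvp).BN u ∈
      (ofThetaSettingData μ hC hS h Q R K' constEmb constEmb_injective hinvc hinvp).constEmb.range)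

include hconst hgc

/-- **F-0535 `ConstantsActByCyclotome` (Lemma 5.8, arithmetic step) at the §5 data of the Setting ⟸ {`hconst`, `hgc`}** (projection of
abc-iut-L2-t4's `facts_ofThetaSettingYddData`). [cite: MochizukiEtTh2009, Lem 5.8 p.331 (PDF p.105)] -/
theorem constantsActByCyclotome_ofThetaSettingYddData :
    (ofThetaSettingData μ hC hS h Q R K' constEmb constEmb_injective hinvc hinvp).ConstantsActByCyclotome :=
  (facts_ofThetaSettingYddData μ hC hS h Q R K' constEmb constEmb_injective hinvc hinvp hconst hgc).constantsActByCyclotome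

/-- **F-0536 `ConstantsEqNormalizer` (Lemma 5.8: "`(O_K^×)^{1/N}` = the elements of `O^×(B_N)` normalising `E_N`") at the §5 data of the
Setting ⟸ {`hconst`, `hgc`}.** [cite: MochizukiEtTh2009, Lem 5.8 p.331 (PDF p.105)] -/
theorem constantsEqNormalizer_ofThetaSettingYddData :
    (ofThetaSettingData μ hC hS h Q R K' constEmb constEmb_injective hinvc hinvp).ConstantsEqNormalizer :=
  (facts_ofThetaSettingYddData μ hC hS h Q R K' constEmb constEmb_injective hinvc hinvp hconst hgc).constantsEqNormalizer

end Constants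

end ThetaFrobenioid

end Literature.AnabelianGeometry.EtaleTheta

end
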